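import Mathlib
import HarnessLib
import Summits.KontsevichZagierPeriods.KontsevichZagierPeriods.Theses.LinRedNormalForm
import Summits.KontsevichZagierPeriods.KontsevichZagierPeriods.Theorems.LinRedNormalFormDihedralNormalFormStubNestedReductionAux1
import Summits.KontsevichZagierPeriods.KontsevichZagierPeriods.Theorems.LinRedNormalFormDihedralNormalFormStubTorusDescentAux1

/-!
# `DihedralNormalForm`, line `torus-descent-sum-shadow`, stub `stub_nestedReduction` — Aux 5

Support file for the stub `stub_nestedReduction` (THEOREM N) of the crux `DihedralNormalForm`
(stmt-KontsevichZagierPeriods-3912, route `LinRedNormalForm`): **calculus of a cubical atom along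
one axis**.  For the atom integrand `atomQ (n+1) q A E` and an axis `p`, on the fibre
`t ↦ Fin.insertNth p t y` through a base point `y ∈ (0,1)ⁿ`:
* every chord factorises, `x_{[i,j]} = t^{[p ∈ [i,j]]} · cof p i j y` (`Nested.cp_insertNth`), so the
  atom is `K(y) · tᴬ⁽ᵖ⁾ · ∏_{[i,j] ∋ p} (1 − t · cof)^{E i j}` (`Nested.atomQ_insertNth`);
* the `t`-derivative is the combination of atoms
  `A p · [A − 𝟙_p, E] − Σ_{[i,j] ∋ p} E i j · [A − 𝟙_p + 𝟙_{[i,j]}, E − δ_{[i,j]}]`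
  (`Nested.hasDerivAt_atomQ_insertNth`): the Newton–Leibniz integrand of phase (N2);
* atom representations on the open cube (`Nested.atomRep`; semialgebraicity from the torus-descent
  tools).

References: M. Kontsevich, D. Zagier, *Periods* (2001), §1.2, rule (3).
-/

noncomputable section

open MeasureTheory Set

namespace Summit.KontsevichZagierPeriods.DihedralNormalForm.TorusDescent

open Literature.NumberTheory.Transcendental
open Literature.ModelTheory.ExponentialFields (IsSemialgebraic)

namespace Nested

variable {n : ℕ}

/-! ## Chords on a fibre -/

/-- The chord cofactor: the product of the base coordinates of `Fin.insertNth p t y` lying in the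
chord `[i,j]` (everything except the axis coordinate). -/
def cof (p i j : Fin (n + 1)) (y : Fin n → ℝ) : ℝ :=
  ∏ l : Fin n, if i ≤ p.succAbove l ∧ p.succAbove l ≤ j then y l else 1

/-- On the fibre through the axis `p`, the chord `[i,j]` is `t^{[p ∈ [i,j]]} · cof`. -/
theorem cp_insertNth (p i j : Fin (n + 1)) (t : ℝ) (y : Fin n → ℝ) :
    (∏ l : Fin (n + 1), if i ≤ l ∧ l ≤ j then (Fin.insertNth p t y : Fin (n + 1) → ℝ) l else 1) =
      (if i ≤ p ∧ p ≤ j then t else 1) * cof p i j y := by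
  rw [Fin.prod_univ_succAbove _ p, cof]
  congr 1
  · split_ifs <;> simp [Fin.insertNth_apply_same]
  · refine Finset.prod_congr rfl fun l _ => ?_
    split_ifs <;> simp [Fin.insertNth_apply_succAbove]

/-- On the fibre, the monomial is `t^{A p}` times the base monomial. -/
theorem prod_pow_insertNth (p : Fin (n + 1)) (A : Fin (n + 1) → ℕ) (t : ℝ) (y : Fin n → ℝ) :
    (∏ l : Fin (n + 1), (Fin.insertNth p t y : Fin (n + 1) → ℝ) l ^ A l) =
      t ^ A p * ∏ l : Fin n, y l ^ A (p.succAbove l) := by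
  rw [Fin.prod_univ_succAbove _ p]
  simp [Fin.insertNth_apply_same, Fin.insertNth_apply_succAbove]

/-- The cofactor is positive over the open cube. -/
theorem cof_pos (p i j : Fin (n + 1)) {y : Fin n → ℝ} (hy : y ∈ ocube n) : 0 < cof p i j y :=
  Finset.prod_pos fun l _ => by
    split_ifs
    · exact (hy l).1
    · exact one_pos

/-- The cofactor is at most `1` over the open cube. -/
theorem cof_le_one (p i j : Fin (n + 1)) {y : Fin n → ℝ} (hy : y ∈ ocube n) : cof p i j y ≤ 1 :=
  Finset.prod_le_one (fun l _ => by split_ifs; exacts [(hy l).1.le, zero_le_one]) fun l _ => by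
    split_ifs; exacts [(hy l).2.le, le_rfl]

/-- A chord containing the axis and another coordinate has cofactor `< 1` over the open cube. -/
theorem cof_lt_one {p i j : Fin (n + 1)} (hij : i ≤ j) (hne : ¬ (i = p ∧ j = p)) {y : Fin n → ℝ}
    (hy : y ∈ ocube n) : cof p i j y < 1 := by
  -- a coordinate `l₀ ≠ p` of the chord
  obtain ⟨m, hm, hmp⟩ : ∃ m : Fin (n + 1), (i ≤ m ∧ m ≤ j) ∧ m ≠ p := by
    by_cases hi : i = p
    · refine ⟨j, ⟨hij, le_rfl⟩, fun hj => hne ⟨hi, hj⟩⟩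
    · exact ⟨i, ⟨le_rfl, hij⟩, hi⟩
  obtain ⟨l₀, rfl⟩ := Fin.exists_succAbove_eq hmp
  rw [cof, ← Finset.mul_prod_erase Finset.univ _ (Finset.mem_univ l₀), if_pos hm]
  have h1 : ∏ l ∈ Finset.univ.erase l₀,
      (if i ≤ p.succAbove l ∧ p.succAbove l ≤ j then y l else 1) ≤ 1 :=
    Finset.prod_le_one (fun l _ => by split_ifs; exacts [(hy l).1.le, zero_le_one]) fun l _ => by
      split_ifs; exacts [(hy l).2.le, le_rfl]
  calc y l₀ * ∏ l ∈ Finset.univ.erase l₀, (if i ≤ p.succAbove l ∧ p.succAbove l ≤ j then y l else 1)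
      ≤ y l₀ * 1 := mul_le_mul_of_nonneg_left h1 (hy l₀).1.le
    _ < 1 := by rw [mul_one]; exact (hy l₀).2

/-! ## The atom on a fibre -/

/-- The chords through the axis `p` (as pairs `(i,j)` with `i ≤ p ≤ j`). -/
def thru (p : Fin (n + 1)) : Finset (Fin (n + 1) × Fin (n + 1)) :=
  Finset.univ.filter fun ij => ij.1 ≤ p ∧ p ≤ ij.2

/-- Membership in `thru`. -/
@[simp] theorem mem_thru {p : Fin (n + 1)} {ij : Fin (n + 1) × Fin (n + 1)} :
    ij ∈ thru p ↔ ij.1 ≤ p ∧ p ≤ ij.2 := by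
  simp [thru]

/-- The base monomial of the fibre factorisation. -/
def bmon (p : Fin (n + 1)) (A : Fin (n + 1) → ℕ) (y : Fin n → ℝ) : ℝ :=
  ∏ l : Fin n, y l ^ A (p.succAbove l)

/-- The product of the chords NOT through the axis (independent of `t`). -/
def rest (p : Fin (n + 1)) (E : Fin (n + 1) → Fin (n + 1) → ℤ) (y : Fin n → ℝ) : ℝ :=
  ∏ ij ∈ Finset.univ.filter (fun ij : Fin (n + 1) × Fin (n + 1) => ij.1 ≤ ij.2 ∧ ¬ (ij.1 ≤ p ∧ p ≤ ij.2)),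
    (1 - cof p ij.1 ij.2 y) ^ E ij.1 ij.2

/-- The `t`-dependent core of the fibre factorisation: `tᴺ · ∏_{[i,j] ∋ p} (1 − t·cof)^{E i j}`. -/
def core (p : Fin (n + 1)) (N : ℕ) (E : Fin (n + 1) → Fin (n + 1) → ℤ) (y : Fin n → ℝ) (t : ℝ) : ℝ :=
  t ^ N * ∏ ij ∈ thru p, (1 - t * cof p ij.1 ij.2 y) ^ E ij.1 ij.2

/-- **Fibre factorisation of an atom**:
`atomQ (insertNth p t y) = (q · bmon · rest) · core (A p) E y t`. -/
theorem atomQ_insertNth (q : ℚ) (A : Fin (n + 1) → ℕ) (E : Fin (n + 1) → Fin (n + 1) → ℤ)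
    (p : Fin (n + 1)) (t : ℝ) (y : Fin n → ℝ) :
    atomQ (n + 1) q A E (Fin.insertNth p t y) =
      ((q : ℝ) * bmon p A y * rest p E y) * core p (A p) E y t := by
  have hchords : (∏ i : Fin (n + 1), ∏ j : Fin (n + 1), if i ≤ j then
      (1 - (∏ l : Fin (n + 1), if i ≤ l ∧ l ≤ j then (Fin.insertNth p t y : Fin (n + 1) → ℝ) l
        else 1)) ^ E i j else (1:ℝ)) =
      (∏ ij ∈ thru p, (1 - t * cof p ij.1 ij.2 y) ^ E ij.1 ij.2) * rest p E y := by
    simp_rw [cp_insertNth]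
    rw [← Fintype.prod_prod_type', ← Finset.prod_filter,
      ← Finset.prod_filter_mul_prod_filter_not _ (fun ij : Fin (n + 1) × Fin (n + 1) => ij.1 ≤ p ∧ p ≤ ij.2)]
    rw [Finset.filter_filter, Finset.filter_filter, rest]
    congr 1
    · have hset : Finset.univ.filter (fun ij : Fin (n + 1) × Fin (n + 1) =>
          ij.1 ≤ ij.2 ∧ (ij.1 ≤ p ∧ p ≤ ij.2)) = thru p := by
        ext ij
        simp only [Finset.mem_filter, Finset.mem_univ, true_and, mem_thru]
        exact ⟨fun h => h.2, fun h => ⟨h.1.trans h.2, h⟩⟩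
      rw [hset]
      refine Finset.prod_congr rfl fun ij hij => ?_
      rw [mem_thru] at hij
      rw [if_pos hij]
    · refine Finset.prod_congr rfl fun ij hij => ?_
      simp only [Finset.mem_filter, Finset.mem_univ, true_and] at hij
      rw [if_neg hij.2, one_mul]
  rw [atomQ, prod_pow_insertNth, hchords, bmon, core]
  ring

/-! ## Updated exponent data -/

/-- `A − 𝟙_p` (meaningful for `A p ≥ 1`). -/
def adown (A : Fin (n + 1) → ℕ) (p : Fin (n + 1)) : Fin (n + 1) → ℕ :=
  Function.update A p (A p - 1)

/-- `A − 𝟙_p + 𝟙_{[i,j]}` for a chord `[i,j] ∋ p`, i.e. `A + 𝟙_{[i,j] ∖ {p}}`. -/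
def aterm (A : Fin (n + 1) → ℕ) (p i j : Fin (n + 1)) : Fin (n + 1) → ℕ :=
  fun l => A l + if i ≤ l ∧ l ≤ j ∧ l ≠ p then 1 else 0

/-- `E − δ_{(i,j)}`. -/
def esub (E : Fin (n + 1) → Fin (n + 1) → ℤ) (i j : Fin (n + 1)) : Fin (n + 1) → Fin (n + 1) → ℤ :=
  fun i' j' => if i' = i ∧ j' = j then E i' j' - 1 else E i' j'

/-- The base monomial of `A − 𝟙_p` is that of `A`. -/
theorem bmon_adown (p : Fin (n + 1)) (A : Fin (n + 1) → ℕ) (y : Fin n → ℝ) :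
    bmon p (adown A p) y = bmon p A y := by
  unfold bmon adown
  refine Finset.prod_congr rfl fun l _ => ?_
  rw [Function.update_of_ne (Fin.succAbove_ne p l)]

/-- The base monomial of `A − 𝟙_p + 𝟙_{[i,j]}` is that of `A` times the cofactor. -/
theorem bmon_aterm (p i j : Fin (n + 1)) (A : Fin (n + 1) → ℕ) (y : Fin n → ℝ) :
    bmon p (aterm A p i j) y = bmon p A y * cof p i j y := by
  unfold bmon aterm cof
  rw [← Finset.prod_mul_distrib]
  refine Finset.prod_congr rfl fun l _ => ?_
  have hne : p.succAbove l ≠ p := Fin.succAbove_ne p l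
  by_cases h : i ≤ p.succAbove l ∧ p.succAbove l ≤ j
  · rw [if_pos ⟨h.1, h.2, hne⟩, if_pos h, pow_succ]
  · rw [if_neg (fun h' => h ⟨h'.1, h'.2.1⟩), if_neg h, add_zero, mul_one]

/-- The axis exponent of `A − 𝟙_p + 𝟙_{[i,j]}` is that of `A`. -/
theorem aterm_self (p i j : Fin (n + 1)) (A : Fin (n + 1) → ℕ) : aterm A p i j p = A p := by
  simp [aterm]

/-- The axis exponent of `A − 𝟙_p`. -/
theorem adown_self (p : Fin (n + 1)) (A : Fin (n + 1) → ℕ) : adown A p p = A p - 1 := by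
  simp [adown]

/-- Removing one power of a chord THROUGH the axis does not change `rest`. -/
theorem rest_esub {p : Fin (n + 1)} {ij : Fin (n + 1) × Fin (n + 1)} (hij : ij ∈ thru p)
    (E : Fin (n + 1) → Fin (n + 1) → ℤ) (y : Fin n → ℝ) :
    rest p (esub E ij.1 ij.2) y = rest p E y := by
  unfold rest esub
  refine Finset.prod_congr rfl fun ij' hij' => ?_
  simp only [Finset.mem_filter, Finset.mem_univ, true_and] at hij'
  rw [mem_thru] at hij
  rw [if_neg]
  rintro ⟨h1, h2⟩
  exact hij'.2 ⟨h1 ▸ hij.1, h2 ▸ hij.2⟩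

/-- Removing one power of the chord `ij ∋ p` in the core product. -/
theorem core_esub {p : Fin (n + 1)} {ij : Fin (n + 1) × Fin (n + 1)} (hij : ij ∈ thru p) (N : ℕ)
    (E : Fin (n + 1) → Fin (n + 1) → ℤ) (y : Fin n → ℝ) (t : ℝ) :
    core p N (esub E ij.1 ij.2) y t = t ^ N * ((1 - t * cof p ij.1 ij.2 y) ^ (E ij.1 ij.2 - 1) *
      ∏ ij' ∈ (thru p).erase ij, (1 - t * cof p ij'.1 ij'.2 y) ^ E ij'.1 ij'.2) := by
  unfold core
  congr 1
  rw [← Finset.mul_prod_erase _ _ hij]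
  congr 1
  · simp [esub]
  · refine Finset.prod_congr rfl fun ij' hij' => ?_
    have hne : ij' ≠ ij := Finset.ne_of_mem_erase hij'
    unfold esub
    rw [if_neg]
    rintro ⟨h1, h2⟩
    exact hne (Prod.ext h1 h2)

/-! ## The derivative along the axis -/

/-- The Newton–Leibniz integrand: `A p · [A − 𝟙_p, E] − Σ_{[i,j] ∋ p} E i j · [A − 𝟙_p + 𝟙_{[i,j]}, E − δ_{ij}]`. -/
def dAtom (q : ℚ) (A : Fin (n + 1) → ℕ) (E : Fin (n + 1) → Fin (n + 1) → ℤ) (p : Fin (n + 1))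
    (x : Fin (n + 1) → ℝ) : ℝ :=
  atomQ (n + 1) (q * A p) (adown A p) E x -
    ∑ ij ∈ thru p, atomQ (n + 1) (q * E ij.1 ij.2) (aterm A p ij.1 ij.2) (esub E ij.1 ij.2) x

/-- Derivative of the core. -/
theorem hasDerivAt_core (p : Fin (n + 1)) (N : ℕ) (E : Fin (n + 1) → Fin (n + 1) → ℤ)
    (y : Fin n → ℝ) {t : ℝ} (ht : ∀ ij ∈ thru p, 1 - t * cof p ij.1 ij.2 y ≠ 0) :
    HasDerivAt (core p N E y)
      ((N : ℝ) * t ^ (N - 1) * (∏ ij ∈ thru p, (1 - t * cof p ij.1 ij.2 y) ^ E ij.1 ij.2) +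
        t ^ N * ∑ ij ∈ thru p, (∏ ij' ∈ (thru p).erase ij, (1 - t * cof p ij'.1 ij'.2 y) ^ E ij'.1 ij'.2) *
          ((E ij.1 ij.2 : ℝ) * (1 - t * cof p ij.1 ij.2 y) ^ (E ij.1 ij.2 - 1) * (-cof p ij.1 ij.2 y))) t := by
  have h1 : HasDerivAt (fun s : ℝ => s ^ N) ((N : ℝ) * t ^ (N - 1)) t := hasDerivAt_pow N t
  have h2 : ∀ ij ∈ thru p, HasDerivAt (fun s : ℝ => (1 - s * cof p ij.1 ij.2 y) ^ E ij.1 ij.2)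
      ((E ij.1 ij.2 : ℝ) * (1 - t * cof p ij.1 ij.2 y) ^ (E ij.1 ij.2 - 1) * (-cof p ij.1 ij.2 y)) t := by
    intro ij hij
    have hlin : HasDerivAt (fun s : ℝ => 1 - s * cof p ij.1 ij.2 y) (-cof p ij.1 ij.2 y) t := by
      simpa using ((hasDerivAt_id' t).mul_const (cof p ij.1 ij.2 y)).const_sub 1
    exact (hasDerivAt_zpow (E ij.1 ij.2) _ (Or.inl (ht ij hij))).comp t hlin
  have h3 := HasDerivAt.fun_finsetProd h2
  simp only [smul_eq_mul] at h3
  have h4 := h1.mul h3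
  unfold core
  exact h4

/-- **The derivative of an atom along an axis.**  On the fibre through a base point over which no
chord through the axis degenerates (`1 − t·cof ≠ 0` for the chords through `p`),
`d/dt atomQ q A E (insertNth p t y) = dAtom q A E p (insertNth p t y)` (for `A p = 0` both sides
read the `ℕ`-truncated `A p − 1 = 0` consistently, the first term having coefficient `0`). -/
theorem hasDerivAt_atomQ_insertNth (q : ℚ) (A : Fin (n + 1) → ℕ) (E : Fin (n + 1) → Fin (n + 1) → ℤ)
    (p : Fin (n + 1)) (y : Fin n → ℝ) {t : ℝ}
    (ht : ∀ ij ∈ thru p, 1 - t * cof p ij.1 ij.2 y ≠ 0) :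
    HasDerivAt (fun s : ℝ => atomQ (n + 1) q A E (Fin.insertNth p s y))
      (dAtom q A E p (Fin.insertNth p t y)) t := by
  have hfun : (fun s : ℝ => atomQ (n + 1) q A E (Fin.insertNth p s y)) =
      fun s => ((q : ℝ) * bmon p A y * rest p E y) * core p (A p) E y s := by
    funext s; exact atomQ_insertNth q A E p s y
  rw [hfun]
  refine ((hasDerivAt_core p (A p) E y ht).const_mul _).congr_deriv ?_
  -- identify the derivative with `dAtom`
  rw [dAtom, atomQ_insertNth, bmon_adown, adown_self, core, Finset.mul_sum, mul_add, Finset.mul_sum,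
    sub_eq_add_neg, ← Finset.sum_neg_distrib]
  congr 1
  · push_cast; ring
  · refine Finset.sum_congr rfl fun ij hij => ?_
    rw [atomQ_insertNth, bmon_aterm, aterm_self, rest_esub hij, core_esub hij]
    push_cast; ring

/-! ## Atom representations on the open cube -/

/-- An atom is `ℚ`-semialgebraic on every `ℚ`-semialgebraic set. -/
theorem isSemialgebraicFunOn_atomQ {m : ℕ} {S : Set (Fin m → ℝ)} (hS : IsSemialgebraic ℚ S) (q : ℚ)
    (A : Fin m → ℕ) (E : Fin m → Fin m → ℤ) : IsSemialgebraicFunOn ℚ S (atomQ m q A E) :=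
  (isSemialgebraicFunOn_const_ratCast hS q).fun_mul
    (isSemialgebraicFunOn_atomFun_comp hS A E (X := fun x => x) fun i => isSemialgebraicFunOn_apply hS i)

/-- A representation on the open cube with a prescribed semialgebraic integrable integrand. -/
def cubeRep (m : ℕ) (f : (Fin m → ℝ) → ℝ) (hf : IsSemialgebraicFunOn ℚ (ocube m) f)
    (hint : IntegrableOn f (ocube m)) : KZ.IntegralRep m where
  domain := ocube m
  integrand := f
  isSemialgebraic_domain := isSemialgebraic_ocube m
  isSemialgebraicFunOn_integrand := hf
  integrableOn := hint

/-- **Atom representations**: `[(0,1)ᵏ, atomQ k q a e]` from absolute convergence. -/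
def atomRep (k : ℕ) (q : ℚ) (a : Fin k → ℕ) (e : Fin k → Fin k → ℤ)
    (h : IntegrableOn (atomQ k q a e) (ocube k)) : KZ.IntegralRep k :=
  cubeRep k (atomQ k q a e) (isSemialgebraicFunOn_atomQ (isSemialgebraic_ocube k) q a e) h

/-- The domain of an atom representation. -/
@[simp] theorem atomRep_domain {k : ℕ} (q : ℚ) (a : Fin k → ℕ) (e : Fin k → Fin k → ℤ)
    (h : IntegrableOn (atomQ k q a e) (ocube k)) : (atomRep k q a e h).domain = ocube k := rfl

/-- The integrand of an atom representation. -/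
@[simp] theorem atomRep_integrand {k : ℕ} (q : ℚ) (a : Fin k → ℕ) (e : Fin k → Fin k → ℤ)
    (h : IntegrableOn (atomQ k q a e) (ocube k)) : (atomRep k q a e h).integrand = atomQ k q a e := rfl

/-- A zero coefficient gives an integrable (zero) atom integrand. -/
theorem integrableOn_atomQ_zero {k : ℕ} (a : Fin k → ℕ) (e : Fin k → Fin k → ℤ) :
    IntegrableOn (atomQ k 0 a e) (ocube k) := by
  have : atomQ k 0 a e = fun _ => 0 := by funext x; simp [atomQ]
  rw [this]
  exact integrableOn_zero

end Nested

/-- **Registered sub-goal `stub_nestedReductionAux5`**: the chords of a cubical atom factorise on the fibres of an axis (`Nested.cp_insertNth`). -/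
theorem stub_nestedReductionAux5 : ∀ (n : ℕ) (p i j : Fin (n + 1)) (t : ℝ) (y : Fin n → ℝ), (∏ l : Fin (n + 1), if i ≤ l ∧ l ≤ j then (Fin.insertNth p t y : Fin (n + 1) → ℝ) l else 1) = (if i ≤ p ∧ p ≤ j then t else 1) * ∏ l : Fin n, if i ≤ p.succAbove l ∧ p.succAbove l ≤ j then y l else 1 :=
  by
  intro n p i j t y
  rw [Nested.cp_insertNth]
  rfl

end Summit.KontsevichZagierPeriods.DihedralNormalForm.TorusDescent
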